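import Summits.Parity.GeneralizedHardyLittlewood.Theorems.FordMaynardNoSieveConst0164NegWitness0164SliceShift
import Summits.Parity.GeneralizedHardyLittlewood.Theorems.FordMaynardNoSieveConst0164NegWitness0164BSplineFive
import Literature.NumberTheory.Sieve.FordMaynardSliceBlocks
import Literature.Analysis.Convolution.OneSidedConvolutionSmooth
import Literature.Analysis.Convolution.ModifiedLiouville

/-!
# Route `FordMaynardNoSieveConst0164`, crux `NegWitness0164` (stmt-Parity-19102), line `birth`,
# stub `stub_tweakNeg0164`: exact-rational lower bounds for the dimension-5 cell integrals of (I')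

Helper file (def-free) for the numerical target (I') of `…NegWitness0164Numerics`
(K. Ford, J. Maynard, *On the theory of prime producing sieves*, arXiv:2407.14368, §8).  For a grid cell
`∏ᵢ [eᵢ, eᵢ + w)` (`eᵢ > 0`) with `S = 1 − Σeᵢ > 0` and centroid abscissa `pᵢ = eᵢ + S/5`:

  `∫_{Δ₅(1)} 𝟙[v ∈ cell]/(v₀⋯v₄) ≥ box_w^{⋆5}(S) / ∏ᵢ pᵢ = w⁴ B₅(S/w) / ∏ᵢ pᵢ`

(`cell_five_ge`: tangent plane of `1/∏vᵢ` at `p` (`inv_prod_tangent_le`), translation to the symmetric box slice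
(`sliceIntegral_translate`), whose first moments are `(S/5)·volume` by symmetry (`sliceIntegral_box_mul_linear`) so
that the linear part integrates to exactly the volume, and `volume = box_w^{⋆5}(S)` (`sliceIntegral_prod_eq_cpow`)).
`cpow_boxFn_scale` rescales to the unit box, and `cell_lower_0164` specialises to the `ν = 41/250`, `w = 7/500` grid:
for `Σtᵢ = T ≤ 12`, `D5(t) ≥ (7/500)⁴ B₅(90/7 − T) / ∏ᵢ ((500 − 7T + 35tᵢ)/2500)`.

References: [FordMaynard2024PrimeSieves] arXiv:2407.14368, §8 (proof of Theorem 2.7 (c)); Jensen / tangent-plane bound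
for the convex function `∏vᵢ⁻¹` (folklore).
-/

noncomputable section

open Finset MeasureTheory Set
open scoped Classical
open Literature.NumberTheory.Sieve Literature.NumberTheory.Sieve.FordMaynard Literature.Analysis.Convolution

namespace Summit.Parity.GeneralizedHardyLittlewood.FordMaynardNoSieveConst0164NegWitness0164

/-! ### The symmetric box slice: volume and affine integrands -/

/-- On the positive orthant the open-box indicator is the product of the box functions `box_w(vᵢ)`. [folklore] -/
theorem box_indicator_eq_prod_boxFn (w : ℝ) (v : Fin 5 → ℝ) (hv : ∀ i, 0 < v i) :
    (if ∀ i, 0 < v i ∧ v i < w then (1 : ℝ) else 0) = ∏ i, boxFn w (v i) := by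
  simp only [boxFn]
  rw [Finset.prod_boole]
  have hiff : (∀ i, 0 < v i ∧ v i < w) ↔ ∀ i ∈ (Finset.univ : Finset (Fin 5)), 0 ≤ v i ∧ v i < w := by
    constructor
    · intro h i _; exact ⟨(hv i).le, (h i).2⟩
    · intro h i; exact ⟨hv i, (h i (Finset.mem_univ i)).2⟩
  by_cases h : ∀ i, 0 < v i ∧ v i < w
  · rw [if_pos h, if_pos (hiff.1 h)]
  · rw [if_neg h, if_neg (mt hiff.2 h)]

/-- **Volume of the symmetric box slice**: `∫_{Δ₅(S)} 𝟙[0 < vᵢ < w] = box_w^{⋆5}(S)` for `S > 0`. [folklore] -/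
theorem sliceIntegral_box_eq_cpow (w : ℝ) {S : ℝ} (hS : 0 < S) :
    sliceIntegral 5 S (fun v => if ∀ i, 0 < v i ∧ v i < w then (1 : ℝ) else 0) = cpow (boxFn w) 5 S := by
  rw [sliceIntegral_congr (G' := fun v => ∏ i, boxFn w (v i))
    (fun v hv _ => box_indicator_eq_prod_boxFn w v hv)]
  exact sliceIntegral_prod_eq_cpow (locBdd_boxFn w) 4 hS

/-- **Affine integrands against the symmetric box slice**: `∫_{Δ₅(S)} 𝟙[0<vᵢ<w](K − Σcᵢvᵢ) = (K − (S/5)Σcᵢ)·∫𝟙`.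
[folklore] -/
theorem sliceIntegral_box_mul_affine (w S K : ℝ) (c : Fin 5 → ℝ) :
    sliceIntegral 5 S (fun v => (if ∀ i, 0 < v i ∧ v i < w then (1 : ℝ) else 0) * (K - ∑ i, c i * v i)) =
      (K - S / 5 * ∑ i, c i) * sliceIntegral 5 S (fun v => if ∀ i, 0 < v i ∧ v i < w then (1 : ℝ) else 0) := by
  set B : (Fin 5 → ℝ) → ℝ := fun v => if ∀ i, 0 < v i ∧ v i < w then (1 : ℝ) else 0 with hB
  have hBm : Measurable B := Measurable.ite (measurableSet_box w) measurable_const measurable_const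
  have hB01 : ∀ v, B v = 0 ∨ (B v = 1 ∧ ∀ i, 0 < v i ∧ v i < w) := by
    intro v; simp only [hB]; split_ifs with h
    · exact Or.inr ⟨rfl, h⟩
    · exact Or.inl rfl
  have hsplit : (fun v => B v * (K - ∑ i, c i * v i)) =
      fun v => (K * B v) + ((-1) * (B v * ∑ i, c i * v i)) := by
    funext v; ring
  -- global bounds
  have hb1 : ∀ v, |K * B v| ≤ |K| + (∑ i, |c i|) * |w| := by
    intro v
    rcases hB01 v with h | ⟨h, _⟩
    · rw [h, mul_zero, abs_zero]; positivity
    · rw [h, mul_one]; have : 0 ≤ (∑ i, |c i|) * |w| := by positivity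
      linarith
  have hb2 : ∀ v, |(-1) * (B v * ∑ i, c i * v i)| ≤ |K| + (∑ i, |c i|) * |w| := by
    intro v
    rcases hB01 v with h | ⟨h, hv⟩
    · rw [h, zero_mul, mul_zero, abs_zero]; positivity
    · rw [h, one_mul, abs_mul, abs_neg, abs_one, one_mul]
      have h1 : |∑ i, c i * v i| ≤ (∑ i, |c i|) * |w| := by
        refine (Finset.abs_sum_le_sum_abs _ _).trans ?_
        rw [Finset.sum_mul]
        refine Finset.sum_le_sum fun i _ => ?_
        rw [abs_mul]
        refine mul_le_mul_of_nonneg_left ?_ (abs_nonneg _)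
        rw [abs_of_pos (hv i).1]
        exact (hv i).2.le.trans (le_abs_self w)
      linarith [abs_nonneg K]
  have hm1 : Measurable fun v => K * B v := measurable_const.mul hBm
  have hm2 : Measurable fun v : Fin 5 → ℝ => (-1) * (B v * ∑ i, c i * v i) :=
    measurable_const.mul (hBm.mul (Finset.measurable_sum _ fun i _ => measurable_const.mul (measurable_pi_apply _)))
  rw [hsplit, sliceIntegral_add' 5 S hm1 hm2 hb1 hb2, sliceIntegral_const_mul, sliceIntegral_const_mul,
    sliceIntegral_box_mul_linear w S c]
  ring

/-! ### Rescaling the box power -/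

/-- `box_w = w · S_{1/w} box_1` (`S_κ f(t) = κ f(κt)`), for `w > 0`. [folklore] -/
theorem boxFn_eq_scaleFn {w : ℝ} (hw : 0 < w) : boxFn w = fun t => w * scaleFn (1 / w) (boxFn 1) t := by
  funext t
  simp only [scaleFn_apply, boxFn]
  have h1 : (0 ≤ 1 / w * t ∧ 1 / w * t < 1) ↔ (0 ≤ t ∧ t < w) := by
    rw [one_div, ← div_eq_inv_mul]
    constructor
    · rintro ⟨h0, h1⟩
      exact ⟨by rwa [le_div_iff₀ hw, zero_mul] at h0, by rwa [div_lt_one hw] at h1⟩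
    · rintro ⟨h0, h1⟩
      exact ⟨div_nonneg h0 hw.le, (div_lt_one hw).2 h1⟩
  simp only [h1]
  split_ifs <;> field_simp

/-- **Rescaling**: `box_w^{⋆5}(w s) = w⁴ · box_1^{⋆5}(s)` for `w > 0`. [folklore] -/
theorem cpow_boxFn_scale {w : ℝ} (hw : 0 < w) (s : ℝ) :
    cpow (boxFn w) 5 (w * s) = w ^ 4 * cpow (boxFn 1) 5 s := by
  rw [boxFn_eq_scaleFn hw, cpow_const_mul, cpow_scaleFn (one_div_pos.2 hw)]
  simp only [scaleFn_apply]
  rw [show 1 / w * (w * s) = s by field_simp]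
  field_simp

/-! ### The cell lower bound -/

/-- **Exact-rational lower bound for a dimension-5 cell integral.** For `eᵢ > 0`, `w > 0`, `S = 1 − Σeᵢ > 0` and
upper edges `e'ᵢ = eᵢ + w`:
`box_w^{⋆5}(S) / ∏ᵢ (eᵢ + S/5) ≤ ∫_{Δ₅(1)} 𝟙[eᵢ ≤ vᵢ < e'ᵢ ∀ i]/(v₀v₁v₂v₃v₄)` (any real `w`)
(tangent plane of the convex `1/∏vᵢ` at the slice-cell centroid; Jensen).
[cite: FordMaynard2024PrimeSieves, §8 (proof of Theorem 2.7 (c)); folklore convexity bound] -/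
theorem cell_five_ge (e e' : Fin 5 → ℝ) (he : ∀ i, 0 < e i) {w : ℝ} (he' : ∀ i, e' i = e i + w)
    (hS : 0 < 1 - ∑ i, e i) :
    cpow (boxFn w) 5 (1 - ∑ i, e i) / ∏ i, (e i + (1 - ∑ i, e i) / 5) ≤
      sliceIntegral 5 1 (fun v => if ∀ i, e i ≤ v i ∧ v i < e' i then
        1 / (v 0 * v 1 * v 2 * v 3 * v 4) else 0) := by
  set S : ℝ := 1 - ∑ i, e i with hSdef
  set p : Fin 5 → ℝ := fun i => e i + S / 5 with hp
  have hp0 : ∀ i, 0 < p i := fun i => by simp only [hp]; linarith [he i]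
  have hpp : 0 < ∏ i, p i := Finset.prod_pos fun i _ => hp0 i
  have hpe : 0 < ∏ i, e i := Finset.prod_pos fun i _ => he i
  -- the tangent-plane minorant on the open cell
  set G₁ : (Fin 5 → ℝ) → ℝ := fun v => if ∀ i, e i < v i ∧ v i < e i + w then
    1 / (∏ i, p i) * (6 - ∑ i, v i / p i) else 0 with hG₁
  -- Step 1: monotonicity
  have hcell_m : MeasurableSet {v : Fin 5 → ℝ | ∀ i, e i ≤ v i ∧ v i < e' i} := by
    have : {v : Fin 5 → ℝ | ∀ i, e i ≤ v i ∧ v i < e' i} = ⋂ i, {v | e i ≤ v i ∧ v i < e' i} := by ext v; simp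
    rw [this]
    exact MeasurableSet.iInter fun i => (measurableSet_le measurable_const (measurable_pi_apply i)).inter
      (measurableSet_lt (measurable_pi_apply i) measurable_const)
  have hopen_m : MeasurableSet {v : Fin 5 → ℝ | ∀ i, e i < v i ∧ v i < e i + w} := by
    have : {v : Fin 5 → ℝ | ∀ i, e i < v i ∧ v i < e i + w} = ⋂ i, {v | e i < v i ∧ v i < e i + w} := by
      ext v; simp
    rw [this]
    exact MeasurableSet.iInter fun i => (measurableSet_lt measurable_const (measurable_pi_apply i)).inter
      (measurableSet_lt (measurable_pi_apply i) measurable_const)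
  have hGm : Measurable fun v : Fin 5 → ℝ => if ∀ i, e i ≤ v i ∧ v i < e' i then
      1 / (v 0 * v 1 * v 2 * v 3 * v 4) else 0 := by
    refine Measurable.ite hcell_m ?_ measurable_const
    exact measurable_const.div ((((measurable_pi_apply 0).mul (measurable_pi_apply 1)).mul
      (measurable_pi_apply 2)).mul (measurable_pi_apply 3) |>.mul (measurable_pi_apply 4))
  have hG₁m : Measurable G₁ := by
    refine Measurable.ite hopen_m ?_ measurable_const
    exact measurable_const.mul (measurable_const.sub
      (Finset.measurable_sum _ fun i _ => (measurable_pi_apply i).div measurable_const))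
  set C : ℝ := max (1 / ∏ i, e i) (1 / (∏ i, p i) * (6 + ∑ i, 1 / p i)) with hC
  have hC0 : 0 ≤ C := le_max_of_le_left (by positivity)
  have hprod5 : ∀ v : Fin 5 → ℝ, v 0 * v 1 * v 2 * v 3 * v 4 = ∏ i, v i := by
    intro v; rw [Fin.prod_univ_five]
  have hGb : ∀ v : Fin 5 → ℝ, (∀ i, 0 < v i) → ∑ i, v i = 1 →
      |(if ∀ i, e i ≤ v i ∧ v i < e' i then 1 / (v 0 * v 1 * v 2 * v 3 * v 4) else 0)| ≤ C := by
    intro v hv _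
    split_ifs with h
    · rw [hprod5, abs_of_pos (one_div_pos.2 (Finset.prod_pos fun i _ => hv i))]
      refine le_trans ?_ (le_max_left _ _)
      exact one_div_le_one_div_of_le hpe (Finset.prod_le_prod (fun i _ => (he i).le) fun i _ => (h i).1)
    · rw [abs_zero]; exact hC0
  have hG₁b : ∀ v : Fin 5 → ℝ, (∀ i, 0 < v i) → ∑ i, v i = 1 → |G₁ v| ≤ C := by
    intro v hv hsum
    simp only [hG₁]
    split_ifs with h
    · refine le_trans ?_ (le_max_right _ _)
      rw [abs_mul, abs_of_pos (one_div_pos.2 hpp)]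
      refine mul_le_mul_of_nonneg_left ?_ (one_div_pos.2 hpp).le
      have h1 : 0 ≤ ∑ i, v i / p i := Finset.sum_nonneg fun i _ => (div_pos (hv i) (hp0 i)).le
      have h2 : ∑ i, v i / p i ≤ ∑ i, 1 / p i := by
        refine Finset.sum_le_sum fun i _ => div_le_div_of_nonneg_right ?_ (hp0 i).le
        calc v i ≤ ∑ j, v j := Finset.single_le_sum (f := v) (fun j _ => (hv j).le) (Finset.mem_univ i)
          _ = 1 := hsum
      rw [abs_le]
      constructor <;> linarith
    · rw [abs_zero]; exact hC0
  have hle : ∀ v : Fin 5 → ℝ, (∀ i, 0 < v i) → ∑ i, v i = 1 →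
      G₁ v ≤ (if ∀ i, e i ≤ v i ∧ v i < e' i then 1 / (v 0 * v 1 * v 2 * v 3 * v 4) else 0) := by
    intro v hv _
    simp only [hG₁]
    by_cases h : ∀ i, e i < v i ∧ v i < e i + w
    · have h' : ∀ i, e i ≤ v i ∧ v i < e' i := fun i => ⟨(h i).1.le, by rw [he' i]; exact (h i).2⟩
      rw [if_pos h, if_pos h', hprod5]
      exact inv_prod_tangent_le v p hv hp0
    · rw [if_neg h]
      split_ifs
      · exact (one_div_pos.2 (by rw [hprod5]; exact Finset.prod_pos fun i _ => hv i)).le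
      · exact le_rfl
  have step1 : sliceIntegral 5 1 G₁ ≤ sliceIntegral 5 1 (fun v => if ∀ i, e i ≤ v i ∧ v i < e' i then
      1 / (v 0 * v 1 * v 2 * v 3 * v 4) else 0) :=
    sliceIntegral_mono_of 4 1 hG₁m hGm hC0 hG₁b hGb hle
  -- Step 2: translation to the symmetric box
  have step2 : sliceIntegral 5 1 G₁ = sliceIntegral 5 S (fun v =>
      (if ∀ i, 0 < v i ∧ v i < w then (1 : ℝ) else 0) *
        (1 / (∏ i, p i) * (6 - ∑ i, e i / p i) - ∑ i, (1 / ((∏ j, p j) * p i)) * v i)) := by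
    rw [sliceIntegral_translate 4 1 e (fun i => (he i).le) G₁ ?_]
    · refine congrArg (sliceIntegral 5 S) (funext fun v => ?_)
      simp only [hG₁, Pi.add_apply]
      have hiff : (∀ i, e i < v i + e i ∧ v i + e i < e i + w) ↔ ∀ i, 0 < v i ∧ v i < w := by
        refine forall_congr' fun i => ?_
        constructor
        · rintro ⟨h1, h2⟩; exact ⟨by linarith, by linarith⟩
        · rintro ⟨h1, h2⟩; exact ⟨by linarith, by linarith⟩
      simp only [hiff]
      split_ifs with h
      · rw [one_mul]
        have h1 : ∑ i, (v i + e i) / p i = ∑ i, e i / p i + ∑ i, v i / p i := by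
          rw [← Finset.sum_add_distrib]
          exact Finset.sum_congr rfl fun i _ => by ring
        have h2 : ∑ i, 1 / ((∏ j, p j) * p i) * v i = (1 / ∏ j, p j) * ∑ i, v i / p i := by
          rw [Finset.mul_sum]
          exact Finset.sum_congr rfl fun i _ => by rw [one_div, mul_inv, one_div, div_eq_mul_inv]; ring
        rw [h1, h2]
        ring
      · rw [zero_mul]
    · intro v ⟨i, hi⟩
      simp only [hG₁]
      rw [if_neg]
      intro h
      exact absurd (h i).1 (not_lt.2 hi)
  -- Step 3: the affine integrand integrates to the volume
  have step3 : sliceIntegral 5 S (fun v =>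
      (if ∀ i, 0 < v i ∧ v i < w then (1 : ℝ) else 0) *
        (1 / (∏ i, p i) * (6 - ∑ i, e i / p i) - ∑ i, (1 / ((∏ j, p j) * p i)) * v i)) =
      1 / (∏ i, p i) * sliceIntegral 5 S (fun v => if ∀ i, 0 < v i ∧ v i < w then (1 : ℝ) else 0) := by
    rw [sliceIntegral_box_mul_affine]
    congr 1
    have h2 : ∑ i, 1 / ((∏ j, p j) * p i) = (1 / ∏ j, p j) * ∑ i, 1 / p i := by
      rw [Finset.mul_sum]
      exact Finset.sum_congr rfl fun i _ => by rw [one_div, mul_inv, one_div, one_div]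
    have h5 : ∑ i, e i / p i + S / 5 * ∑ i, 1 / p i = 5 := by
      have hi : ∀ i, e i / p i + S / 5 * (1 / p i) = 1 := fun i => by
        rw [show e i / p i + S / 5 * (1 / p i) = (e i + S / 5) / p i by ring,
          show e i + S / 5 = p i from rfl, div_self (hp0 i).ne']
      calc ∑ i, e i / p i + S / 5 * ∑ i, 1 / p i = ∑ i, (e i / p i + S / 5 * (1 / p i)) := by
            rw [Finset.mul_sum, ← Finset.sum_add_distrib]
        _ = ∑ _i : Fin 5, (1 : ℝ) := Finset.sum_congr rfl fun i _ => hi i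
        _ = 5 := by simp
    rw [h2]
    have h6 : 6 - ∑ i, e i / p i - S / 5 * ∑ i, 1 / p i = 1 := by linarith
    calc 1 / (∏ i, p i) * (6 - ∑ i, e i / p i) - S / 5 * (1 / (∏ j, p j) * ∑ i, 1 / p i)
        = 1 / (∏ i, p i) * (6 - ∑ i, e i / p i - S / 5 * ∑ i, 1 / p i) := by ring
      _ = 1 / ∏ i, p i := by rw [h6, mul_one]
  -- Step 4: the volume is the box power
  rw [step2, step3, sliceIntegral_box_eq_cpow w hS] at step1
  rw [div_eq_mul_one_div, mul_comm]
  simpa [hp] using step1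

/-- **The grid specialisation** (`ν = 41/250`, `w = 7/500`): for a cell index `t` with `Σtᵢ = T ≤ 12` and
`B = box_1^{⋆5}(90/7 − T)`,
`(7/500)⁴ B / ∏ᵢ ((500 − 7T + 35tᵢ)/2500) ≤ ∫_{Δ₅(1)} 𝟙[v ∈ cell t]/(v₀⋯v₄)`.
[cite: FordMaynard2024PrimeSieves, §8 (proof of Theorem 2.7 (c))] -/
theorem cell_lower_0164 (t : Fin 5 → Fin 24) (T : ℕ)
    (hT : (t 0 : ℕ) + (t 1 : ℕ) + (t 2 : ℕ) + (t 3 : ℕ) + (t 4 : ℕ) = T) (hT12 : T ≤ 12)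
    (B : ℝ) (hB : cpow (boxFn 1) 5 (90 / 7 - T) = B) :
    (7 / 500 : ℝ) ^ 4 * B / (((500 - 7 * T + 35 * (t 0 : ℕ)) / 2500) * ((500 - 7 * T + 35 * (t 1 : ℕ)) / 2500) *
      ((500 - 7 * T + 35 * (t 2 : ℕ)) / 2500) * ((500 - 7 * T + 35 * (t 3 : ℕ)) / 2500) *
      ((500 - 7 * T + 35 * (t 4 : ℕ)) / 2500)) ≤
      sliceIntegral 5 1 (fun v =>
        if ∀ i, (41 / 250 + (t i : ℕ) * (7 / 500) : ℝ) ≤ v i ∧ v i < 41 / 250 + ((t i : ℕ) + 1) * (7 / 500) then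
          1 / (v 0 * v 1 * v 2 * v 3 * v 4) else 0) := by
  have hTsum : ∑ i, ((t i : ℕ) : ℝ) = T := by
    rw [Fin.sum_univ_five]; exact_mod_cast hT
  have hS : (1 : ℝ) - ∑ i, (41 / 250 + ((t i : ℕ) : ℝ) * (7 / 500)) = 7 / 500 * (90 / 7 - T) := by
    rw [Finset.sum_add_distrib, ← Finset.sum_mul, hTsum]
    simp only [Finset.sum_const, Finset.card_univ, Fintype.card_fin, nsmul_eq_mul, Nat.cast_ofNat]
    ring
  have hT' : (T : ℝ) ≤ 12 := by exact_mod_cast hT12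
  have hSpos : (0 : ℝ) < 1 - ∑ i, (41 / 250 + ((t i : ℕ) : ℝ) * (7 / 500)) := by
    rw [hS]; nlinarith
  have key := cell_five_ge (fun i => 41 / 250 + ((t i : ℕ) : ℝ) * (7 / 500))
    (fun i => 41 / 250 + (((t i : ℕ) : ℝ) + 1) * (7 / 500)) (fun i => by positivity)
    (w := 7 / 500) (fun i => by ring) hSpos
  rw [hS, cpow_boxFn_scale (by norm_num : (0 : ℝ) < 7 / 500), hB] at key
  refine le_trans (le_of_eq ?_) key
  simp only [Fin.prod_univ_five]
  ring

end Summit.Parity.GeneralizedHardyLittlewood.FordMaynardNoSieveConst0164NegWitness0164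

end
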